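import Summits.AtomisticToContinuum.BoseEinsteinCondensation.Theorems.BoxHorizonTransfer

/-!
# Box energy horizon transfer — part 2/2: the FAR method door (coherence of near-minimisers + one witness) and the assembled kernels
(decomp-a2c lens-6 g31 `HorizonTransfer.lean` sha256 d2c799c0…, lines 375–497, split into two modules at the gate's 400-line limit; content
byte-identical; namespace kept `…BoxHorizonTransfer`).  Imports part 1 (§0–§3: superblocks, LD `HorizonLocalDepletion`, DOM `TwoScaleDomination`,
`near_of_localDepletion_domination`).  Gate-forced delta: lens-6's `NearMinimiserCoherence` is renamed `BoxNearMinimiserCoherence` here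
(`helper.identity`: the bare name is owned by the route decl `Theses.BECImaginaryTimeTransport.NearMinimiserCoherence`).
-/

noncomputable section

open MeasureTheory Filter Set
open scoped ENNReal NNReal BigOperators Topology ComplexConjugate

namespace Summit.AtomisticToContinuum.BoseEinsteinCondensation.Theorems.BoxHorizonTransfer

open Literature.MathematicalPhysics.QuantumManyBody.BoseGas
open Summit.AtomisticToContinuum.BoseEinsteinCondensation.Theorems.BoxLatticeFSum
open Summit.AtomisticToContinuum.BoseEinsteinCondensation.Theorems.BoxEnergyHorizon

/-! ### §4  The FAR method door: coherence of near-minimisers + one witness -/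

/-- Overlap defect `1 - |⟨Ψ, Φ⟩|²` of two `N`-body wave functions (for unit vectors `∈ [0, 1]`;
`‖|Ψ⟩⟨Ψ| - |Φ⟩⟨Φ|‖₁ = 2√(1 - |⟨Ψ,Φ⟩|²)`). [folklore] -/
def overlapDefect {N : ℕ} (Ψ Φ : Config N → ℂ) : ℝ :=
  1 - ‖∫ X, (starRingEnd ℂ) (Ψ X) * Φ X‖ ^ 2

/-- **COH** (piece · TAG TRUE-type · KNOWN in print, COSTUME(cite) · Lean-blocked on Rellich–Kondrachov)
`BoxNearMinimiserCoherence`: below a density cap, eventually in `N`, Dirichlet near-minimisers are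
mutually coherent — for every `ε > 0` there is `δ > 0` such that any two `δ`-near-minimisers have
overlap defect `≤ ε`.  Mechanism: `E₀ < ∞` (dilute cap), compact resolvent of the Friedrichs extension on
the finite-energy configuration space (Rellich–Kondrachov on the bounded box), Perron–Frobenius
uniqueness of the ground state `Ψ₀ > 0` (connected finite-energy region: hard cores of diameter `a` at
`ρa³ ≪ 1` do not disconnect), spectral gap `E₁ - E₀ > 0` at fixed `N, L`; then
`1 - |⟨Ψ,Ψ₀⟩|² ≤ δ/(E₁ - E₀)` and the defect of two near-minimisers is `≤ 4δ/(E₁-E₀)`.  Why it might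
fail: an `IsRepulsiveFiniteRange` potential may carry `+∞` shells (`v = ⊤` on `[2a,3a]`) that
disconnect the finite-energy configuration space; then ground states can degenerate and COH is false
for that `v` — the class may need `{v = ⊤}` to be an initial segment. [cite: LSSY2005, Ch. 2 §2.1;
folklore (Reed–Simon IV, Thm. XIII.47 and XIII.64)] -/
@[conjecture] def BoxNearMinimiserCoherence : Prop :=
  ∀ v : ℝ → ℝ≥0∞, IsRepulsiveFiniteRange v →
    ∃ ρ₀ : ℝ, 0 < ρ₀ ∧ ∀ ρ : ℝ, 0 < ρ → ρ < ρ₀ →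
      ∀ᶠ N : ℕ in atTop, ∀ ε : ℝ, 0 < ε → ∃ δ : ℝ≥0∞, 0 < δ ∧
        ∀ Ψ Φ : TrialState N (sideLength ρ N),
          energy v Ψ ≤ groundStateEnergy v N (sideLength ρ N) + δ →
          energy v Φ ≤ groundStateEnergy v N (sideLength ρ N) + δ →
            overlapDefect Ψ.ψ Φ.ψ ≤ ε

/-- **LIP** (support · TAG TRUE · PROVABLE·M — kinematics) `OccupationCoherenceLipschitz`: the total
occupation of any family of DCT block waves (orthonormal: `dct3_orthonormal`, so `Σ_{q∈S} |g_q⟩⟨g_q|`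
is a projection `P_S`) is `2N√(defect)`-Lipschitz between wave functions:
`|Tr P_S(γ_Ψ - γ_Φ)| ≤ ‖γ_Ψ - γ_Φ‖₁ ≤ N ‖|Ψ⟩⟨Ψ| - |Φ⟩⟨Φ|‖₁ = 2N√(1 - |⟨Ψ,Φ⟩|²)`.  Why it is not
physics: it holds for all `Ψ, Φ`. [folklore] -/
@[conjecture] def OccupationCoherenceLipschitz : Prop :=
  ∀ (N : ℕ) (L : ℝ), 0 < L → ∀ K : ℕ, 0 < K → ∀ S : Finset (SubIdx K),
    ∀ Ψ Φ : TrialState N L,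
      (∑ q ∈ S, occupation N (boxBlockWave L K q) Ψ.ψ) ≤
        (∑ q ∈ S, occupation N (boxBlockWave L K q) Φ.ψ) +
          ENNReal.ofReal (2 * N * Real.sqrt (overlapDefect Ψ.ψ Φ.ψ))

/-- **WIT** (crux · TAG UNDECIDED · DECLARED RESIDUAL of the FAR door · IDEA-NEEDED · outside the
`KineticGapLengthScales*` class BY CONSTRUCTION) `SubHorizonWitness`: FAR asked of ONE near-minimiser
instead of all — for `a > 0` and every `κ, C > 0` there are `A > 0` and a density cap below which,
eventually in `N`, for EVERY `δ > 0` SOME Dirichlet `δ`-near-minimiser `Φ` puts at most `N/64` into the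
sub-horizon DCT band `0 < ε_P < Θ_E`, for every even `K` in the window.  The twist / boost / cat
witnesses of the barrier catalogue are irrelevant here: the statement is existential in the state, and
`δ ↓ 0` at FIXED `N, L` goes below every kinetic gap `4π²/L²`.  Why it might fail: it is implied by FAR
(so not harder), but every constructive candidate (`e^{-tH}` applied to a condensed positive seed,
Feynman–Kac / Perron–Frobenius iteration from the free ground state, the LSSY trial states pushed to
`o(1)` excess energy) needs an infrared estimate on the FLOW that is not in print.  Why WEAKER than FAR:
with a degenerate ground state (disconnected finite-energy region) one ground state may be condensed
and another not — WIT holds, FAR fails. [cite: LSSY2005, Ch. 5 §5.1–5.2 (5.15)–(5.24)] -/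
@[conjecture] def SubHorizonWitness : Prop :=
  ∀ v : ℝ → ℝ≥0∞, IsRepulsiveFiniteRange v → 0 < scatteringLength v →
    ∀ κ : ℝ, 0 < κ → ∀ C : ℝ, 0 < C → ∃ A : ℝ, 0 < A ∧ ∃ ρ₀ : ℝ, 0 < ρ₀ ∧
      ∀ ρ : ℝ, 0 < ρ → ρ < ρ₀ →
      ∀ᶠ N : ℕ in atTop, ∀ δ : ℝ≥0∞, 0 < δ → ∃ Φ : TrialState N (sideLength ρ N),
        energy v Φ ≤ groundStateEnergy v N (sideLength ρ N) + δ ∧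
        ∀ K : ℕ, Even K → 0 < K → InWindow A ρ (sideLength ρ N) K →
          (∑ q ∈ (Finset.univ.filter fun q : SubIdx K =>
              0 < pathDispersion K q ∧
                pathDispersion K q < horizonThreshold C κ (scatteringLength v).toReal A ρ),
            occupation N (boxBlockWave (sideLength ρ N) K q) Φ.ψ) ≤ ENNReal.ofReal ((N : ℝ) / 64)

set_option maxHeartbeats 800000 in
/-- **FAR ⟸ COH ∧ LIP ∧ WIT** (`SubHorizonEmptiness` through the coherence door): with `ε := (3/128)²`,
COH's `δ` and WIT's witness `Φ` at that `δ`, every `δ`-near-minimiser `Ψ` has sub-horizon occupation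
`≤ N/64 + 2N·(3/128) = N/16`. [folklore] -/
theorem far_of_coherence_witness (hCoh : BoxNearMinimiserCoherence) (hLip : OccupationCoherenceLipschitz)
    (hWit : SubHorizonWitness) : SubHorizonEmptiness := by
  intro v hv hapos κ hκ C hC
  obtain ⟨A, hA, ρW, hρW, hW⟩ := hWit v hv hapos κ hκ C hC
  obtain ⟨ρC, hρC, hCo⟩ := hCoh v hv
  refine ⟨A, hA, min ρW ρC, lt_min hρW hρC, fun ρ hρ hρlt => ?_⟩
  have hρ1 : ρ < ρW := lt_of_lt_of_le hρlt (min_le_left _ _)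
  have hρ2 : ρ < ρC := lt_of_lt_of_le hρlt (min_le_right _ _)
  have hevL : ∀ᶠ N : ℕ in atTop, 1 ≤ sideLength ρ N :=
    (tendsto_sideLength_atTop hρ).eventually_ge_atTop _
  filter_upwards [hW ρ hρ hρ1, hCo ρ hρ hρ2, hevL] with N hWN hCN hL1
  have hL : 0 < sideLength ρ N := lt_of_lt_of_le one_pos hL1
  have hε : (0 : ℝ) < (3 / 128) ^ 2 := by positivity
  obtain ⟨δ, hδ, hclose⟩ := hCN (((3 : ℝ) / 128) ^ 2) hε
  refine ⟨δ, hδ, fun Ψ hE K hK hK0 hWin => ?_⟩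
  obtain ⟨Φ, hEΦ, hband⟩ := hWN δ hδ
  have hdef : overlapDefect Ψ.ψ Φ.ψ ≤ ((3 : ℝ) / 128) ^ 2 := hclose Ψ Φ hE hEΦ
  have hsq : Real.sqrt (overlapDefect Ψ.ψ Φ.ψ) ≤ 3 / 128 := by
    calc Real.sqrt (overlapDefect Ψ.ψ Φ.ψ) ≤ Real.sqrt (((3 : ℝ) / 128) ^ 2) :=
          Real.sqrt_le_sqrt hdef
      _ = 3 / 128 := Real.sqrt_sq (by norm_num)
  have hN0 : (0 : ℝ) ≤ (N : ℝ) := Nat.cast_nonneg _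
  have hT : 2 * (N : ℝ) * Real.sqrt (overlapDefect Ψ.ψ Φ.ψ) ≤ 2 * (N : ℝ) * (3 / 128) :=
    mul_le_mul_of_nonneg_left hsq (by positivity)
  calc (∑ q ∈ (Finset.univ.filter fun q : SubIdx K =>
            0 < pathDispersion K q ∧
              pathDispersion K q < horizonThreshold C κ (scatteringLength v).toReal A ρ),
          occupation N (boxBlockWave (sideLength ρ N) K q) Ψ.ψ)
      ≤ (∑ q ∈ (Finset.univ.filter fun q : SubIdx K =>
            0 < pathDispersion K q ∧
              pathDispersion K q < horizonThreshold C κ (scatteringLength v).toReal A ρ),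
          occupation N (boxBlockWave (sideLength ρ N) K q) Φ.ψ) +
          ENNReal.ofReal (2 * N * Real.sqrt (overlapDefect Ψ.ψ Φ.ψ)) :=
        hLip N _ hL K hK0 _ Ψ Φ
    _ ≤ ENNReal.ofReal ((N : ℝ) / 64) + ENNReal.ofReal (2 * (N : ℝ) * (3 / 128)) :=
        add_le_add (hband K hK hK0 hWin) (ENNReal.ofReal_le_ofReal hT)
    _ = ENNReal.ofReal ((N : ℝ) / 64 + 2 * (N : ℝ) * (3 / 128)) :=
        (ENNReal.ofReal_add (by positivity) (by positivity)).symm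
    _ = ENNReal.ofReal ((N : ℝ) / 16) := by ring_nf

/-! ### §5  Assembled kernels over tree theorems -/

/-- **`BoseEinsteinCondensation ⟸ SB ∧ LD ∧ DOM ∧ FAR`** — the box line of record with NEAR transferred.
[folklore] -/
theorem bec_of_shellBudget_transfer (hSB : BoxShellBudget) (hLD : HorizonLocalDepletion)
    (hDOM : TwoScaleDomination) (hFar : SubHorizonEmptiness) : _root_.BoseEinsteinCondensation :=
  bec_of_shellBudget_horizon hSB (near_of_localDepletion_domination hLD hDOM) hFar

/-- **`BoseEinsteinCondensation ⟸ SB ∧ LD ∧ DOM ∧ COH ∧ LIP ∧ WIT`** — both halves of DE through their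
doors. [folklore] -/
theorem bec_of_shellBudget_transfer_witness (hSB : BoxShellBudget) (hLD : HorizonLocalDepletion)
    (hDOM : TwoScaleDomination) (hCoh : BoxNearMinimiserCoherence) (hLip : OccupationCoherenceLipschitz)
    (hWit : SubHorizonWitness) : _root_.BoseEinsteinCondensation :=
  bec_of_shellBudget_transfer hSB hLD hDOM (far_of_coherence_witness hCoh hLip hWit)

end Summit.AtomisticToContinuum.BoseEinsteinCondensation.Theorems.BoxHorizonTransfer

end
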